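import Literature.MathematicalPhysics.QuantumLattice.LTQORelativeBoundProofs
import Literature.MathematicalPhysics.QuantumLattice.StabilityTorusGeometryProofs
import HarnessLib

/-!
# The relative form bound on the torus, summed over radius classes (MZ13 Proposition 2)

Top-down layer (seat B) of the formalisation of the Michalakis–Zwolak stability theorem
(hubbard.S19, `Literature.MathematicalPhysics.QuantumLattice.michalakis_zwolak`). Michalakis–Zwolak,
CMP **322** (2013) 277 = arXiv:1109.1588, §6 Proposition 2: for a frustration-free, locally gapped
projector Hamiltonian `H₀` on the torus and a perturbation `W = Σ_u Σ_r W_u(r)` whose pieces are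
annihilated by the local ground states, `W_u(r) P_{b_u(r)} = 0`, one has
`|⟨ψ, W ψ⟩| ≤ c J ⟨ψ, H₀ ψ⟩` with `c = C_d Σ_k r_k^d ŵ(r_k)/γ(r_k)`.

The abstract one-family estimate is `norm_inner_sum_le_of_locallyAnnihilated`
(`LTQORelativeBoundProofs`, seat A). Here it is applied on the decorated torus `(ℤ/Lℤ)^d × κ`
radius by radius — family `u ↦ W u j` attached to the balls `cellBall u j`, local gap `γloc j`
(`HasLocalGap`), weight `κ_j = w j / γloc j`, multiplicity `(2j + 1)^d`
(`card_filter_subset_cellBall_le`) — and summed over `j ≤ N`: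

`‖⟨x, (Σ_u Σ_{j ≤ N} W u j) x⟩‖ ≤ (Σ_{j ≤ N} (2j+1)^d w j / γloc j) · re ⟨x, H₀ x⟩`

(`norm_inner_sum_pieces_le`). This is exactly the printed constant with the radius classes
`{r_k} = {0, …, N}` and `C_d r^d ↦ (2r+1)^d`. Also: `Φ ∅ = 0` for a projector interaction with a
non-trivial local ground space (`apply_empty_eq_zero_of_localGroundProj_ne_zero`), needed because
the empty region lies in every ball. No definitions, no named facts (theorems only).
-/

noncomputable section

open Matrix Finset Module
open scoped InnerProductSpace ComplexOrder Matrix.Norms.L2Operator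

namespace Literature.MathematicalPhysics.QuantumLattice

open Literature.Probability.LatticeModels

section Empty

variable {Λ : Type*} [Fintype Λ] [DecidableEq Λ] {q : ℕ}

/-- A term of a local interaction at the empty region is `0` as soon as some local ground-state
projection is non-zero: `Φ ∅` kills every local ground-state vector (`∅ ⊆ B`), and it is
supported on `∅`, i.e. a scalar `a • 1`; a scalar killing a non-zero vector is `0`. [folklore] -/
theorem apply_empty_eq_zero_of_localGroundProj_ne_zero {Φ : Interaction Λ q}
    (hloc : Φ.IsLocal) {B : Finset Λ} (hB : localGroundProj Φ B ≠ 0) : Φ ∅ = 0 := by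
  classical
  -- `Φ ∅ = a • 1` for a scalar `a`
  obtain ⟨A, hA⟩ := hloc.isSupportedOn ∅
  set ι₀ : (↥(∅ : Finset Λ)) → Fin q := fun x => (Finset.notMem_empty (x : Λ) x.2).elim with hι₀
  have huniq : ∀ f : (↥(∅ : Finset Λ)) → Fin q, f = ι₀ := fun f =>
    funext fun x => (Finset.notMem_empty (x : Λ) x.2).elim
  have ha : Φ ∅ = A ι₀ ι₀ • (1 : Op Λ q) := by
    rw [← hA]
    ext σ τ
    simp only [localOp_apply, Matrix.smul_apply, Matrix.one_apply, smul_eq_mul, mul_ite, mul_one,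
      mul_zero]
    by_cases h : σ = τ
    · subst h
      rw [if_pos (fun y _ => rfl), if_pos rfl, huniq (fun x => σ x)]
    · rw [if_neg h, if_neg]
      intro h'
      exact h (funext fun y => h' y (Finset.notMem_empty y))
  set a : ℂ := A ι₀ ι₀ with hadef
  -- if `a ≠ 0`, `Φ ∅ = a • 1` kills only `0`, but it kills every column of `P_B ≠ 0`
  by_contra hne
  have ha0 : a ≠ 0 := by
    intro h0
    rw [h0, zero_smul] at ha
    exact hne ha
  apply hB
  rw [ext_iff_mulVec]
  intro v
  have hmem := projMatrix_map_mulVec_mem (localGroundSpace Φ B) v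
  have h0 : Φ ∅ *ᵥ (localGroundProj Φ B *ᵥ v) = 0 :=
    (mem_localGroundSpace_iff Φ B _).1 hmem ∅ (empty_subset _)
  rw [ha, smul_mulVec, one_mulVec, smul_eq_zero] at h0
  rcases h0 with h | h
  · exact absurd h ha0
  · rw [zero_mulVec]; exact h

end Empty

section Torus

variable {d L : ℕ} [NeZero L] {κ : Type*} [Fintype κ] [DecidableEq κ] {q : ℕ}

/-- **MZ13 Proposition 2 on the torus, one radius class.** For a projector interaction `Φ` with
`Φ ∅ = 0` and the local gap `γ_j > 0` at every ball of radius `j`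
(`HasClusterGap H_{b_u(j)} (dim ker) 0 γ_j`), a family `W u`, `u ∈ (ℤ/Lℤ)^d`, of pieces annihilated
by `P_{b_u(j)}` on both sides with `‖W u‖ ≤ w`, `0 ≤ w`, satisfies
`‖⟨x, (Σ_u W u) x⟩‖ ≤ (w/γ_j) (2j+1)^d re ⟨x, H₀ x⟩`.
[cite: MichalakisZwolakCMP2013, §6 Proposition 2 (arXiv:1109.1588 pp. 13–15)] -/
theorem norm_inner_sum_radius_le {Φ : Interaction (TorusSite d L × κ) q}
    (hΦ : IsProjectorInteraction Φ) (hΦ0 : Φ ∅ = 0) {j : ℕ} {γj : ℝ} (hγj : 0 < γj)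
    (hgap : ∀ u : TorusSite d L, (localHamiltonian Φ (cellBall u j)).HasClusterGap
      (finrank ℂ (localGroundSpace Φ (cellBall u j : Finset (TorusSite d L × κ)))) 0 γj)
    (W : TorusSite d L → Op (TorusSite d L × κ) q)
    (hWP : ∀ u, W u * localGroundProj Φ (cellBall u j) = 0)
    (hPW : ∀ u, localGroundProj Φ (cellBall u j) * W u = 0)
    {w : ℝ} (hw0 : 0 ≤ w) (hw : ∀ u, ‖W u‖ ≤ w)
    (x : EuclideanSpace ℂ (TensorIndex (TorusSite d L × κ) q)) :
    ‖⟪x, toEuclideanLin (∑ u, W u) x⟫_ℂ‖ ≤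
      w / γj * (2 * j + 1) ^ d * RCLike.re ⟪x, toEuclideanLin (localHamiltonian Φ univ) x⟫_ℂ := by
  have h := norm_inner_sum_le_of_locallyAnnihilated hΦ (univ : Finset (TorusSite d L))
    (fun u => (cellBall u j : Finset (TorusSite d L × κ))) W (fun _ => γj) (κ := w / γj)
    (div_nonneg hw0 hγj.le) (C := (2 * j + 1) ^ d) (fun u _ => hgap u) (fun u _ => hWP u)
    (fun u _ => hPW u) (fun u _ => by rw [div_mul_cancel₀ _ hγj.ne']; exact hw u) ?_ x
  · simpa [Nat.cast_pow] using h
  · intro Z hZ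
    have hZne : Z.Nonempty := by
      rw [nonempty_iff_ne_empty]
      rintro rfl
      exact hZ hΦ0
    exact card_filter_subset_cellBall_le hZne j

/-- **MZ13 Proposition 2 on the torus, summed over radius classes.** With pieces `W u j`
annihilated by `P_{b_u(j)}` and bounded by `w j`, and local gaps `γloc j > 0` (`HasLocalGap`):
`‖⟨x, (Σ_u Σ_{j ≤ N} W u j) x⟩‖ ≤ (Σ_{j ≤ N} (2j+1)^d w j / γloc j) re ⟨x, H₀ x⟩`. This is
`|⟨ψ, W ψ⟩| ≤ c J ⟨ψ, H₀ ψ⟩`, `c = C_d Σ_k r_k^d ŵ(r_k)/γ(r_k)`, of MZ13 (arXiv:1109.1588 p. 13)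
with the radius classes `{0, …, N}`. [cite: MichalakisZwolakCMP2013, §6 Proposition 2 (arXiv:1109.1588 pp. 13–15)] -/
theorem norm_inner_sum_pieces_le {Φ : Interaction (TorusSite d L × κ) q}
    (hΦ : IsProjectorInteraction Φ) (hΦ0 : Φ ∅ = 0) {γloc : ℕ → ℝ} (hloc : HasLocalGap Φ γloc)
    (hγ : ∀ j, 0 < γloc j) (W : TorusSite d L → ℕ → Op (TorusSite d L × κ) q) (N : ℕ)
    (hWP : ∀ u j, W u j * localGroundProj Φ (cellBall u j) = 0)
    (hPW : ∀ u j, localGroundProj Φ (cellBall u j) * W u j = 0)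
    {w : ℕ → ℝ} (hw0 : ∀ j, 0 ≤ w j) (hw : ∀ u j, ‖W u j‖ ≤ w j)
    (x : EuclideanSpace ℂ (TensorIndex (TorusSite d L × κ) q)) :
    ‖⟪x, toEuclideanLin (∑ u, ∑ j ∈ range (N + 1), W u j) x⟫_ℂ‖ ≤
      (∑ j ∈ range (N + 1), (2 * j + 1) ^ d * w j / γloc j) *
        RCLike.re ⟪x, toEuclideanLin (localHamiltonian Φ univ) x⟫_ℂ := by
  rw [Finset.sum_comm, map_sum, LinearMap.sum_apply, inner_sum, sum_mul]
  refine (norm_sum_le _ _).trans (sum_le_sum fun j _ => ?_)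
  have h := norm_inner_sum_radius_le hΦ hΦ0 (hγ j) (fun u => hloc u j) (fun u => W u j)
    (fun u => hWP u j) (fun u => hPW u j) (hw0 j) (fun u => hw u j) x
  refine h.trans (le_of_eq ?_)
  ring

end Torus

end Literature.MathematicalPhysics.QuantumLattice
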